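import Literature.MathematicalPhysics.QuantumFieldTheory.ONArchipelagoSystem
import Literature.MathematicalPhysics.QuantumFieldTheory.ONMixedNonVacuity
import HarnessLib

/-!
# Non-vacuity of the typed `O(N)` archipelago axioms A1–A5 (`ONArchipelagoSystem.SatisfiesBootstrapAxioms`):
# `N + 1` decoupled generalised free fields are an `ArchipelagoData N` with GENUINE typed blocks satisfying
# all seven sum rules, so every excluded box misses — and every enclosure keeps — the admitted free points

Topic `MathematicalPhysics/QuantumFieldTheory`; definitions + theorems only (no named fact, no instance, no
`sorry`, no new axiom).  The companion of `ONArchipelagoSystem.lean` [KosPolandSimmonsDuffinVichi2015] at the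
level of its AXIOMS, exactly as `ConformalBootstrap3D/DecoupledPairNonVacuity.lean` is the companion of the
`σ–ε` axioms of `ConformalBootstrap3D/SigmaEpsilonSystem.lean`: where `ONMixedNonVacuity.lean` shows that no
seven-component POINT FUNCTIONAL exists on a spectrum containing the decoupled generalised free solution, this
file packages that solution as a bona fide `ArchipelagoData N` — index types, dimensions, spins, OPE
coefficients and block FUNCTIONS of `(z, z̄)` — and proves `SatisfiesBootstrapAxioms (gffArch N p q)
(gffGapsON p q)` for every `N` and all `p, q > 1/2` (§4), hence the set-level consequences for the source's
two claim shapes (`BoxExcluded`, `ArchipelagoEnclosure`): an excluded box never contains an admitted free point,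
an enclosure always retains it (§4).  This is the typed form of the remark in `ONArchipelagoSystem.lean` that
"the window hypothesis is essential (generalised free fields satisfy A1–A5 with suitable thresholds)", and the
calibration any client certificate under these axioms must pass.
Honest framing: this file is bookkeeping over published material (the seven equations, block conventions and
functional conditions of [KosPolandSimmonsDuffinVichi2015, §2.1–2.2], the generalised free `O(N)` correlator of
[HenrikssonVanLoon2018, §2], the generalised-free decompositions of [FitzpatrickKaplan2012, §2.2] in the blocks
of [DolanOsborn2004, §3] / [HogervorstRychkov2013, §3] as formalised under `ConformalBootstrap3D/`); it serves
shared numerical engines whose rigour lives in their verifiers, and every published number belongs to a client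
cell's ledger, not to this file — no bound, island or exclusion plot is asserted or touched here.

SOURCES (held texts `paper:arxiv-1504.07997` = [KosPolandSimmonsDuffinVichi2015], `paper:arxiv-1801.03512`
= [HenrikssonVanLoon2018]; the quotations are the ones carried verbatim by `ONArchipelagoSystem.lean`,
`ONMixedSumRule.lean` and `ONVectorNonVacuity.lean`):
* [KosPolandSimmonsDuffinVichi2015, §2, §2.1]: the conformal block expansion with `g^{Δ_ij,Δ_kl}_{Δ,ℓ}`, the
  crossing functions `F^{ij,kl}_{∓,Δ,ℓ} = v^{(Δ_k+Δ_j)/2} g(u,v) ∓ u^{(Δ_k+Δ_j)/2} g(v,u)` and the seven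
  equations with `V⃗_T, V⃗_A, V⃗_V, V⃗_S` — the tree's `ArchipelagoData.SatisfiesCrossing` (seven `HasSum` rows in
  the `crossF` normalisation of `ConformalBootstrap3D`).
* [KosPolandSimmonsDuffinVichi2015, §2.2]: unitarity, parity of spins per sector, reality of OPE coefficients,
  the gap assumptions and `λ_{φφs} = λ_{φsφ}` — the tree's A1, A4, A5.
* [HenrikssonVanLoon2018, §2]: `𝒢^{(0)}_S = 1 + (u^{Δφ}/N)(1 + v^{−Δφ})`, `𝒢^{(0)}_T = u^{Δφ}(1 + v^{−Δφ})`,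
  `𝒢^{(0)}_A = u^{Δφ}(1 − v^{−Δφ})`, in the tree's Kos–Poland–Simmons-Duffin normalisation `gffT = ½(u^p + (u/v)^p)`,
  `gffA = ½((u/v)^p − u^p)` of `ONVectorNonVacuity.lean`; double twists of even spin in `S, T`, odd spin in `A`.
* [FitzpatrickKaplan2012, §2.2] via `MeanFieldDecomposition.lean` / `MeanFieldAllSpins.lean`:
  `Σ_{n,m} 2P_{n,2m}(p) g_{2p+2n+2m,2m}(z,z̄) = u^p(1 + v^{−p})` (`hasSum_gff_blocks`), the all-spin sums
  `Σ P_{n,ℓ} g = (u/v)^p`, `Σ (−1)^ℓ P_{n,ℓ} g = u^p` (`hasSum_mft_blocks_uv/_u`), `P ≥ 0`, for `p > 1/2`.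
* [FitzpatrickKaplan2012, §2.2], [DolanOsborn2004, §3 eqs. (3.10)–(3.11)] via `MeanFieldDecompositionAB.lean`:
  (I) `Σ (−1)^ℓ P_{n,ℓ}(p,q) g^{p−q,p−q}_{p+q+2n+ℓ,ℓ} = u^{(p+q)/2}`, (II) `Σ P_{n,ℓ}(p,q) g^{−(p−q),p−q}_{p+q+2n+ℓ,ℓ}
  = u^{(p+q)/2} v^{−p}` (`hasSum_gffPair_blocks_I/_II`), `P_{n,ℓ}(p,q) ≥ 0`, unitarity `pair_unitarity`.
* [HogervorstRychkov2013, §3] via `BlockExistence*.lean`: the typed blocks `hrBlock`, `hrBlockAB` are genuine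
  (`IsAdmissible3D.isConformalBlock3D_hrBlock`, `isConformalBlock3D_hrBlockAB_of_lt`).

THE WITNESS (§1).  `gffArch N p q : ArchipelagoData N` — externals `(Δ_φ, Δ_s) = (p, q)`, all three external
couplings zero (decoupling), singlet sector `[φₖφₖ]_{n,2m} ⊔ [ss]_{n,2m}` with the `ONMixedNonVacuity` weights
`lamPhiPhi N p`, `lamSS q`, `T`/`A` = even/odd double twists `[φφ]_{n,ℓ}` with `λ² = P_{n,ℓ}(p)`, `V` = `[φs]_{n,ℓ}`
(all spins) with `λ² = P_{n,ℓ}(p,q)` and the two mixed block families; every block a typed Hogervorst–Rychkov sum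
as a function of `(z, z̄)`.  THE SUMS (§2): the five sector sums at any `(z, z̄) ∈ (0,1)²`, in closed form.
THE SEVEN ROWS (§3, `gffArch_satisfiesCrossing`): rows 1–3 cancel identically in `N` (so the theorem holds for
every `N : ℕ`, the junk value `1/0 = 0` included), rows 4–7 by the two-line identities in the docstring.
THE AXIOMS AND CONSEQUENCES (§4): A2 (`gffArch_hasGenuineBlocks`), A1 (`gffArch_satisfiesUnitarity`,
`gffArch_hasConvergentWeights`), A4 against `gffGapsON p q = (min(2p,2q), p+q, 2p)` (`gffArch_satisfiesGaps`), A5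
(`rfl`); `gffArch_satisfiesBootstrapAxioms`, `…_of_le`; `not_mem_of_archBoxExcluded`, `not_archBoxExcluded_of_mem`, `min_lt_gapS_of_boxExcluded`,
`mem_of_archipelagoEnclosure`; and the placement of the source's thresholds `Δ_S^* = Δ_V^* = 3`
(`three_le_gffGapsON_iff`, `not_mem_of_archBoxExcluded_three`): they dominate `gffGapsON` exactly on `p, q ≥ 3/2`,
far from the printed islands — the decoupled datum obstructs no exclusion there, as it must not.

LIMITS.  Nothing here evaluates a block numerically, asserts a bound, or touches a certificate; the blocks are
the tree's typed sums and all identities are kernel-checked consequences of the imported decompositions.  The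
datum is the DECOUPLED theory only (interacting data are the clients' business); `N = 0, 1` are admitted as
junk/degenerate instances of the same algebra, with no physical claim.
-/

noncomputable section

namespace Literature.MathematicalPhysics.QuantumFieldTheory.ONArchipelagoNonVacuity

open Set
open Literature.MathematicalPhysics.QuantumFieldTheory.ConformalBootstrap3D
open Literature.MathematicalPhysics.QuantumFieldTheory.ONArchipelagoSystem
open Literature.MathematicalPhysics.QuantumFieldTheory.ONVectorNonVacuity
open Literature.MathematicalPhysics.QuantumFieldTheory.ONMixedNonVacuity

/-! ## §1 The datum: `N` generalised free `O(N)`-vector scalars `φ_i` of dimension `p` and a decoupled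
generalised free singlet `s` of dimension `q` -/

section Datum

variable (N : ℕ) (p q : ℝ)

/-- **The decoupled generalised free archipelago datum** `gffArch N p q : ArchipelagoData N`.
Externals `Δ_φ = p`, `Δ_s = q`; external couplings `λ_{φφs} = λ_{sss} = λ_{φsφ} = 0` (decoupling: `s ∉ φ × φ`,
`φ ∉ φ × s`), external blocks the genuine `g^{0,0}_{q,0}`, `g^{±(p−q),p−q}_{p,0}` (present in the axioms,
weightless here).  Singlet sector `ιS = (ℕ × ℕ) ⊕ (ℕ × ℕ)`: `inl (n,m)` = the `O(N)` singlet double twist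
`[φₖφₖ]_{n,2m}` at `(2p+2n+2m, 2m)` with `(λ_{φφ𝒪}, λ_{ss𝒪}) = (√(2P_{n,2m}(p)/N), 0)`, `inr (n,m)` = `[ss]_{n,2m}`
at `(2q+2n+2m, 2m)` with `(0, √(2P_{n,2m}(q)))` (`lamPhiPhi`, `lamSS` of `ONMixedNonVacuity`); `T`: `[φφ]_{n,2m}`
with `λ² = P_{n,2m}(p)`; `A`: `[φφ]_{n,2m+1}` with `λ² = P_{n,2m+1}(p)`; `V`: `[φ s]_{n,ℓ}`, all spins, with
`λ² = P_{n,ℓ}(p,q)` and the two block families `g^{p−q,p−q}`, `g^{−(p−q),p−q}`.  All blocks are the typed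
Hogervorst–Rychkov sums `hrBlock` / `hrBlockAB` as functions of `(z, z̄)`.
[cite: KosPolandSimmonsDuffinVichi2015, §2.1 (seven equations; `V⃗_T, V⃗_A, V⃗_V, V⃗_S`)]
[cite: HenrikssonVanLoon2018, §2 (generalized free O(N) correlator and OPE coefficients)] [cite: FitzpatrickKaplan2012, §2.2] -/
def gffArch : ArchipelagoData N where
  Δφ := p
  Δs := q
  lamφφs := 0
  lamsss := 0
  lamφsφ := 0
  gs := hrBlock q 0
  gφm := hrBlockAB (p - q) (p - q) p 0
  gφp := hrBlockAB (-(p - q)) (p - q) p 0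
  ιS := (ℕ × ℕ) ⊕ (ℕ × ℕ)
  ΔS := Sum.elim (fun nm : ℕ × ℕ => 2 * p + 2 * nm.1 + 2 * nm.2) (fun nm => 2 * q + 2 * nm.1 + 2 * nm.2)
  ℓS := Sum.elim (fun nm : ℕ × ℕ => 2 * nm.2) (fun nm => 2 * nm.2)
  lamφφS := lamPhiPhi N p
  lamssS := lamSS q
  gS := Sum.elim (fun nm : ℕ × ℕ => hrBlock (2 * p + 2 * nm.1 + 2 * nm.2) (2 * nm.2))
    (fun nm => hrBlock (2 * q + 2 * nm.1 + 2 * nm.2) (2 * nm.2))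
  ιT := ℕ × ℕ
  ΔT := fun nm => 2 * p + 2 * nm.1 + 2 * nm.2
  ℓT := fun nm => 2 * nm.2
  lamT := fun nm => Real.sqrt (mftCoeff p nm.1 (2 * nm.2))
  gT := fun nm => hrBlock (2 * p + 2 * nm.1 + 2 * nm.2) (2 * nm.2)
  ιA := ℕ × ℕ
  ΔA := fun nm => 2 * p + 2 * (nm.1 : ℝ) + ((2 * nm.2 + 1 : ℕ) : ℝ)
  ℓA := fun nm => 2 * nm.2 + 1
  lamA := fun nm => Real.sqrt (mftCoeff p nm.1 (2 * nm.2 + 1))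
  gA := fun nm => hrBlock (2 * p + 2 * (nm.1 : ℝ) + ((2 * nm.2 + 1 : ℕ) : ℝ)) (2 * nm.2 + 1)
  ιV := ℕ × ℕ
  ΔV := fun nl => p + q + 2 * nl.1 + nl.2
  ℓV := fun nl => nl.2
  lamV := fun nl => Real.sqrt (mftCoeffAB p q nl.1 nl.2)
  gVm := fun nl => hrBlockAB (p - q) (p - q) (p + q + 2 * nl.1 + nl.2) nl.2
  gVp := fun nl => hrBlockAB (-(p - q)) (p - q) (p + q + 2 * nl.1 + nl.2) nl.2

/-- **The thresholds the decoupled theory satisfies**: singlet scalars other than `s` have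
`Δ ≥ min(2p, 2q)` (`[φφ]_{0,0}`, `[ss]_{0,0}`), vector scalars other than `φ` have `Δ ≥ p + q` (`[φs]_{0,0}`),
traceless-symmetric scalars have `Δ ≥ 2p`. [cite: KosPolandSimmonsDuffinVichi2015, §2.2 (assumptions; eq. example)]
[cite: FitzpatrickKaplan2012, §2.2] -/
def gffGapsON : ArchipelagoGaps := ⟨min (2 * p) (2 * q), p + q, 2 * p⟩

end Datum

/-! ## §2 The sector sums at a point `(z, z̄) ∈ (0,1)²` -/

section Sums

variable {N : ℕ} {p q z zb : ℝ}

/-- `u^p (1 + v^{−p}) = u^p + u^p / v^p` (`u = z z̄`, `v = (1−z)(1−z̄)`). Plumbing. [folklore] -/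
private theorem mfc_eq (p z zb : ℝ) : meanFieldCorrelator p z zb =
    (z * zb) ^ p + (z * zb) ^ p / ((1 - z) * (1 - zb)) ^ p := by
  unfold meanFieldCorrelator; ring

/-- The same at the crossed point `(1−z, 1−z̄)`. Plumbing. [folklore] -/
private theorem mfc_swap_eq (p z zb : ℝ) : meanFieldCorrelator p (1 - z) (1 - zb) =
    ((1 - z) * (1 - zb)) ^ p + ((1 - z) * (1 - zb)) ^ p / (z * zb) ^ p := by
  unfold meanFieldCorrelator; simp only [sub_sub_cancel]; ring

/-- **Singlet sector, `λ²_{φφ𝒪}` weights**: `Σ_S λ²_{φφ𝒪} g_𝒪(z,z̄) = (1/N)(u^p + u^p v^{−p}) = 𝒢_S − 1`.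
[cite: HenrikssonVanLoon2018, §2 (𝒢^{(0)}_S and a^{GFF})] [cite: FitzpatrickKaplan2012, §2.2] -/
theorem hasSum_S_phiphi (hp : 1 / 2 < p) (hz : z ∈ Ioo (0 : ℝ) 1) (hzb : zb ∈ Ioo (0 : ℝ) 1) :
    HasSum (fun i => (gffArch N p q).lamφφS i ^ 2 * (gffArch N p q).gS i z zb)
      (1 / (N : ℝ) * ((z * zb) ^ p + (z * zb) ^ p / ((1 - z) * (1 - zb)) ^ p)) := by
  rw [← mfc_eq]
  change HasSum (fun i : (ℕ × ℕ) ⊕ (ℕ × ℕ) => (gffArch N p q).lamφφS i ^ 2 * (gffArch N p q).gS i z zb) _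
  have h1 : HasSum ((fun i : (ℕ × ℕ) ⊕ (ℕ × ℕ) => (gffArch N p q).lamφφS i ^ 2 * (gffArch N p q).gS i z zb) ∘ Sum.inl)
      (1 / (N : ℝ) * meanFieldCorrelator p z zb) := by
    refine ((hasSum_gff_blocks hp hz hzb).mul_left (1 / (N : ℝ))).congr_fun fun nm => ?_
    simp only [Function.comp_apply, gffArch, lamPhiPhi, Sum.elim_inl, Real.sq_sqrt (gffS_weight_nonneg N hp nm)]
    ring
  have h2 : HasSum ((fun i : (ℕ × ℕ) ⊕ (ℕ × ℕ) => (gffArch N p q).lamφφS i ^ 2 * (gffArch N p q).gS i z zb) ∘ Sum.inr) 0 := by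
    refine (hasSum_zero (α := ℝ) (β := ℕ × ℕ)).congr_fun fun nm => ?_
    simp [gffArch, lamPhiPhi]
  simpa using h1.sum h2

/-- **Singlet sector, `λ²_{ss𝒪}` weights**: `Σ_S λ²_{ss𝒪} g_𝒪(z,z̄) = u^q + u^q v^{−q} = G^{ss}_S − 1`.
[cite: FitzpatrickKaplan2012, §2.2] [cite: KosPolandSimmonsDuffinVichi2015, §2.1 (`V⃗_S`)] -/
theorem hasSum_S_ss (hq : 1 / 2 < q) (hz : z ∈ Ioo (0 : ℝ) 1) (hzb : zb ∈ Ioo (0 : ℝ) 1) :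
    HasSum (fun i => (gffArch N p q).lamssS i ^ 2 * (gffArch N p q).gS i z zb)
      ((z * zb) ^ q + (z * zb) ^ q / ((1 - z) * (1 - zb)) ^ q) := by
  rw [← mfc_eq]
  change HasSum (fun i : (ℕ × ℕ) ⊕ (ℕ × ℕ) => (gffArch N p q).lamssS i ^ 2 * (gffArch N p q).gS i z zb) _
  have h1 : HasSum ((fun i : (ℕ × ℕ) ⊕ (ℕ × ℕ) => (gffArch N p q).lamssS i ^ 2 * (gffArch N p q).gS i z zb) ∘ Sum.inl) 0 := by
    refine (hasSum_zero (α := ℝ) (β := ℕ × ℕ)).congr_fun fun nm => ?_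
    simp [gffArch, lamSS]
  have h2 : HasSum ((fun i : (ℕ × ℕ) ⊕ (ℕ × ℕ) => (gffArch N p q).lamssS i ^ 2 * (gffArch N p q).gS i z zb) ∘ Sum.inr)
      (meanFieldCorrelator q z zb) := by
    refine (hasSum_gff_blocks hq hz hzb).congr_fun fun nm => ?_
    simp only [Function.comp_apply, gffArch, lamSS, Sum.elim_inr, Real.sq_sqrt (gffOPECoeffSq_pos hq nm).le]
  simpa using h1.sum h2

/-- **Singlet sector, mixed weights**: `Σ_S λ_{φφ𝒪} λ_{ss𝒪} g_𝒪 = 0` — no operator couples to both `φφ` and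
`ss` in the decoupled theory. [cite: KosPolandSimmonsDuffinVichi2015, §2.1 (seven equations, rows 6–7)] -/
theorem hasSum_S_phis (N : ℕ) (p q z zb : ℝ) :
    HasSum (fun i => (gffArch N p q).lamφφS i * (gffArch N p q).lamssS i * (gffArch N p q).gS i z zb) 0 := by
  refine (hasSum_zero (α := ℝ)).congr_fun fun i => ?_
  rcases i with nm | nm <;> simp [gffArch, lamPhiPhi, lamSS]

/-- **`T` sector**: `Σ_T λ² g(z,z̄) = (u^p + u^p v^{−p})/2 = 𝒢_T` (even spins, weights `P_{n,2m}(p)`).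
[cite: HenrikssonVanLoon2018, §2 (𝒢^{(0)}_T)] [cite: FitzpatrickKaplan2012, §2.2] -/
theorem hasSum_T (hp : 1 / 2 < p) (hz : z ∈ Ioo (0 : ℝ) 1) (hzb : zb ∈ Ioo (0 : ℝ) 1) :
    HasSum (fun i => (gffArch N p q).lamT i ^ 2 * (gffArch N p q).gT i z zb)
      (((z * zb) ^ p + (z * zb) ^ p / ((1 - z) * (1 - zb)) ^ p) / 2) := by
  have e : ((z * zb) ^ p + (z * zb) ^ p / ((1 - z) * (1 - zb)) ^ p) / 2 =
      (1 / 2 : ℝ) * meanFieldCorrelator p z zb := by rw [mfc_eq]; ring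
  rw [e]
  refine ((hasSum_gff_blocks hp hz hzb).mul_left (1 / 2 : ℝ)).congr_fun fun nm => ?_
  simp only [gffArch, gffOPECoeffSq, Real.sq_sqrt (mftCoeff_nonneg hp _ _)]
  ring

/-- **`A` sector**: `Σ_A λ² g(z,z̄) = (u^p v^{−p} − u^p)/2 = 𝒢_A` — ODD spins, weights `P_{n,2m+1}(p)`: half the
difference of the tree's all-spin decompositions `Σ P g = (u/v)^p` and `Σ (−1)^ℓ P g = u^p`, re-indexed by
`ℓ = 2m+1` (the even terms vanish). [cite: HenrikssonVanLoon2018, §2 (𝒢^{(0)}_A and the odd-spin OPE coefficients)]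
[cite: FitzpatrickKaplan2012, §2.2] -/
theorem hasSum_A (hp : 1 / 2 < p) (hz : z ∈ Ioo (0 : ℝ) 1) (hzb : zb ∈ Ioo (0 : ℝ) 1) :
    HasSum (fun i => (gffArch N p q).lamA i ^ 2 * (gffArch N p q).gA i z zb)
      (((z * zb) ^ p / ((1 - z) * (1 - zb)) ^ p - (z * zb) ^ p) / 2) := by
  have huv := hasSum_mft_blocks_uv hp hz hzb
  have hu := hasSum_mft_blocks_u hp hz hzb
  have hs := (huv.sub hu).mul_left (1 / 2 : ℝ)
  have hval : (1 / 2 : ℝ) * ((z * zb) ^ p / ((1 - z) * (1 - zb)) ^ p - (z * zb) ^ p) =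
      ((z * zb) ^ p / ((1 - z) * (1 - zb)) ^ p - (z * zb) ^ p) / 2 := by ring
  rw [hval] at hs
  set f : ℕ × ℕ → ℝ := fun m => (1 / 2 : ℝ) * (mftCoeff p m.1 m.2 * hrBlock (2 * p + 2 * m.1 + m.2) m.2 z zb -
    (-1 : ℝ) ^ m.2 * mftCoeff p m.1 m.2 * hrBlock (2 * p + 2 * m.1 + m.2) m.2 z zb) with hf
  have hs' : HasSum f (((z * zb) ^ p / ((1 - z) * (1 - zb)) ^ p - (z * zb) ^ p) / 2) := by
    convert hs using 1
  set g : ℕ × ℕ → ℕ × ℕ := fun nm => (nm.1, 2 * nm.2 + 1) with hg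
  have hginj : Function.Injective g := by
    intro a b hab
    simp only [hg, Prod.mk.injEq] at hab
    exact Prod.ext hab.1 (by omega)
  have hzero : ∀ x ∉ Set.range g, f x = 0 := by
    intro x hx
    have heven : Even x.2 := by
      rcases Nat.even_or_odd x.2 with he | ⟨r, hr⟩
      · exact he
      · exact absurd ⟨(x.1, r), by simp only [hg]; exact Prod.ext rfl (by omega)⟩ hx
    simp only [hf, heven.neg_one_pow]
    ring
  have hfg := (hginj.hasSum_iff hzero).mpr hs'
  change HasSum (fun i : ℕ × ℕ => (gffArch N p q).lamA i ^ 2 * (gffArch N p q).gA i z zb) _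
  convert hfg using 1
  funext nm
  have hodd : Odd (2 * nm.2 + 1) := ⟨nm.2, rfl⟩
  simp only [Function.comp, hg, hf, gffArch, hodd.neg_one_pow, Real.sq_sqrt (mftCoeff_nonneg hp _ _)]
  push_cast
  ring

/-- **`V` sector, family `g^{p−q,p−q}`** (for `⟨φsφs⟩`, with the row sign `(−1)^ℓ`):
`Σ_V (−1)^ℓ λ² g^{p−q,p−q}_{Δ,ℓ}(z,z̄) = u^{(p+q)/2}` (the tree's decomposition (I)).
[cite: FitzpatrickKaplan2012, §2.2] [cite: DolanOsborn2004, §3 eqs. (3.10)–(3.11)] -/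
theorem hasSum_Vm (hp : 1 / 2 < p) (hq : 1 / 2 < q) (hz : z ∈ Ioo (0 : ℝ) 1) (hzb : zb ∈ Ioo (0 : ℝ) 1) :
    HasSum (fun j => (-1 : ℝ) ^ (gffArch N p q).ℓV j * (gffArch N p q).lamV j ^ 2 * (gffArch N p q).gVm j z zb)
      ((z * zb) ^ ((p + q) / 2)) := by
  refine (hasSum_gffPair_blocks_I hp hq hz hzb).congr_fun fun nl => ?_
  simp only [gffArch, Real.sq_sqrt (mftCoeffAB_nonneg hp hq _ _)]

/-- **`V` sector, family `g^{−(p−q),p−q}`** (for `⟨sφφs⟩`): `Σ_V λ² g^{−(p−q),p−q}_{Δ,ℓ}(z,z̄) = u^{(p+q)/2} v^{−p}`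
(the tree's decomposition (II)). [cite: FitzpatrickKaplan2012, §2.2] [cite: DolanOsborn2004, §3 eqs. (3.10)–(3.11)] -/
theorem hasSum_Vp (hp : 1 / 2 < p) (hq : 1 / 2 < q) (hz : z ∈ Ioo (0 : ℝ) 1) (hzb : zb ∈ Ioo (0 : ℝ) 1) :
    HasSum (fun j => (gffArch N p q).lamV j ^ 2 * (gffArch N p q).gVp j z zb)
      ((z * zb) ^ ((p + q) / 2) / ((1 - z) * (1 - zb)) ^ p) := by
  refine (hasSum_gffPair_blocks_II hp hq hz hzb).congr_fun fun nl => ?_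
  simp only [gffArch, Real.sq_sqrt (mftCoeffAB_nonneg hp hq _ _)]

/-- **Linearity of `F^±_x`**: if the weighted block family sums at `(z,z̄)` and at `(1−z,1−z̄)`, its
`crossF`-image sums to the corresponding combination. Plumbing. [folklore] -/
private theorem hasSum_crossF {ι : Type*} {w : ι → ℝ} {g : ι → ℝ → ℝ → ℝ} {a b : ℝ} (x s : ℝ)
    (ha : HasSum (fun i => w i * g i z zb) a) (hb : HasSum (fun i => w i * g i (1 - z) (1 - zb)) b) :
    HasSum (fun i => w i * crossF x s (g i) z zb) (((1 - z) * (1 - zb)) ^ x * a + s * (z * zb) ^ x * b) := by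
  refine ((ha.mul_left (((1 - z) * (1 - zb)) ^ x)).add (hb.mul_left (s * (z * zb) ^ x))).congr_fun
    fun i => ?_
  simp only [crossF]
  ring

end Sums

/-! ## §3 A3: the seven sum rules -/

section Crossing

variable {N : ℕ} {p q : ℝ}

/-- Four `F^±` brackets of the generalised free channel functions. Plumbing. [folklore] -/
private theorem brackets {a b : ℝ} (ha : a ≠ 0) (hb : b ≠ 0) :
    b * (a + a / b) - a * (b + b / a) = a - b ∧ b * (a / b - a) - a * (b / a - b) = a - b ∧
      b * (a + a / b) + a * (b + b / a) = 2 * (a * b) + a + b ∧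
        b * (a / b - a) + a * (b / a - b) = a + b - 2 * (a * b) := by
  refine ⟨?_, ?_, ?_, ?_⟩ <;> field_simp <;> ring

/-- **A3 for the decoupled archipelago datum — all seven sum rules** at every `z, z̄ ∈ (0,1)`.
With `a = u^p`, `b = v^p` (`u = z z̄`, `v = (1−z)(1−z̄)`): rows 1–3 (`⟨φφφφ⟩`): `F⁻[𝒢_T] = F⁻[𝒢_A] = (a−b)/2`,
`F⁻[𝒢_S − 1] = (a−b)/N`, `F⁻[1] = b − a`, and the `F⁺` analogues, so the three `O(N)` rows cancel identically
in `N`; row 4 (`⟨ssss⟩`): `F⁻_q[G^{ss} − 1] = u^q − v^q = −F⁻_q[1]`; row 5 (`⟨φsφs⟩`): `F⁻_h[u^h] = v^h u^h − u^h v^h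
= 0`; rows 6–7 (`⟨φφss⟩ ± ⟨sφφs⟩`): the singlet sum vanishes termwise and `F^∓_p[u^h v^{−p}] = u^h ∓ v^h`
cancels `F^∓_h[1] = v^h ∓ u^h`. [cite: KosPolandSimmonsDuffinVichi2015, §2.1 (seven equations; `V⃗_T, V⃗_A, V⃗_V, V⃗_S`)]
[cite: HenrikssonVanLoon2018, §2 (crossing of the generalized free correlator)] -/
theorem gffArch_satisfiesCrossing (hp : 1 / 2 < p) (hq : 1 / 2 < q) : (gffArch N p q).SatisfiesCrossing := by
  intro z zb hz hzb
  have hz' : 1 - z ∈ Ioo (0 : ℝ) 1 := ⟨by linarith [hz.2], by linarith [hz.1]⟩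
  have hzb' : 1 - zb ∈ Ioo (0 : ℝ) 1 := ⟨by linarith [hzb.2], by linarith [hzb.1]⟩
  have hu : 0 < z * zb := mul_pos hz.1 hzb.1
  have hv : 0 < (1 - z) * (1 - zb) := mul_pos hz'.1 hzb'.1
  -- the sector sums at `(z, z̄)` and at `(1 − z, 1 − z̄)`
  have hS := hasSum_S_phiphi (N := N) (q := q) hp hz hzb
  have hS' := hasSum_S_phiphi (N := N) (q := q) hp hz' hzb'
  have hSS := hasSum_S_ss (N := N) (p := p) hq hz hzb
  have hSS' := hasSum_S_ss (N := N) (p := p) hq hz' hzb'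
  have hT := hasSum_T (N := N) (q := q) hp hz hzb
  have hT' := hasSum_T (N := N) (q := q) hp hz' hzb'
  have hA := hasSum_A (N := N) (q := q) hp hz hzb
  have hA' := hasSum_A (N := N) (q := q) hp hz' hzb'
  have hVm := hasSum_Vm (N := N) hp hq hz hzb
  have hVm' := hasSum_Vm (N := N) hp hq hz' hzb'
  have hVp := hasSum_Vp (N := N) hp hq hz hzb
  have hVp' := hasSum_Vp (N := N) hp hq hz' hzb'
  have h0 := hasSum_S_phis N p q z zb
  have h0' := hasSum_S_phis N p q (1 - z) (1 - zb)
  simp only [sub_sub_cancel] at hS' hSS' hT' hA' hVm' hVp'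
  -- abbreviations
  set a : ℝ := (z * zb) ^ p with ha
  set b : ℝ := ((1 - z) * (1 - zb)) ^ p with hb
  set c : ℝ := (z * zb) ^ q with hc
  set d : ℝ := ((1 - z) * (1 - zb)) ^ q with hd
  set e : ℝ := (z * zb) ^ ((p + q) / 2) with he
  set e' : ℝ := ((1 - z) * (1 - zb)) ^ ((p + q) / 2) with he'
  have ha0 : a ≠ 0 := (Real.rpow_pos_of_pos hu _).ne'
  have hb0 : b ≠ 0 := (Real.rpow_pos_of_pos hv _).ne'
  obtain ⟨k1, k2, k3, k4⟩ := brackets ha0 hb0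
  have hΔφ : (gffArch N p q).Δφ = p := rfl
  have hΔs : (gffArch N p q).Δs = q := rfl
  have hΔh : (gffArch N p q).Δh = (p + q) / 2 := rfl
  have hl1 : (gffArch N p q).lamφφs = 0 := rfl
  have hl2 : (gffArch N p q).lamsss = 0 := rfl
  have hl3 : (gffArch N p q).lamφsφ = 0 := rfl
  refine ⟨⟨_, _, hasSum_crossF _ _ hT hT', hasSum_crossF _ _ hA hA', ?_⟩,
    ⟨_, _, _, hasSum_crossF _ _ hS hS', hasSum_crossF _ _ hT hT', hasSum_crossF _ _ hA hA', ?_⟩,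
    ⟨_, _, _, hasSum_crossF _ _ hS hS', hasSum_crossF _ _ hT hT', hasSum_crossF _ _ hA hA', ?_⟩,
    ?_, ?_, ⟨_, _, hasSum_crossF _ _ h0 h0', hasSum_crossF _ _ hVp hVp', ?_⟩,
    ⟨_, _, hasSum_crossF _ _ h0 h0', hasSum_crossF _ _ hVp hVp', ?_⟩⟩
  · -- row 1
    rw [hΔφ, ← ha, ← hb]
    linear_combination (1 / 2 : ℝ) * k1 - (1 / 2 : ℝ) * k2
  · -- row 2
    rw [hΔφ, hl1]
    simp only [crossF, mul_one, ← ha, ← hb]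
    linear_combination (1 / (N : ℝ) + (1 - 2 / (N : ℝ)) / 2) * k1 + (1 / 2 : ℝ) * k2
  · -- row 3
    rw [hΔφ, hl1]
    simp only [crossF, mul_one, ← ha, ← hb]
    linear_combination (1 / (N : ℝ) - (1 + 2 / (N : ℝ)) / 2) * k3 - (1 / 2 : ℝ) * k4
  · -- row 4
    have h4 := hasSum_crossF q (-1) hSS hSS'
    rw [hΔs, hl2]
    have hc0 : c ≠ 0 := (Real.rpow_pos_of_pos hu _).ne'
    have hd0 : d ≠ 0 := (Real.rpow_pos_of_pos hv _).ne'
    have ev : d * (c + c / d) + (-1) * c * (d + d / c) =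
        -(crossF q (-1) (fun _ _ => (1 : ℝ)) z zb + (0 : ℝ) ^ 2 * crossF q (-1) (hrBlock q 0) z zb) := by
      simp only [crossF, mul_one, ← hc, ← hd]
      field_simp
      ring
    rw [← hc, ← hd, ev] at h4
    exact h4
  · -- row 5
    have h5 := hasSum_crossF ((p + q) / 2) (-1) hVm hVm'
    rw [hΔh, hl3]
    have ev : ((1 - z) * (1 - zb)) ^ ((p + q) / 2) * e + (-1) * (z * zb) ^ ((p + q) / 2) * e' =
        -((0 : ℝ) ^ 2 * crossF ((p + q) / 2) (-1) (hrBlockAB (p - q) (p - q) p 0) z zb) := by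
      rw [← he, ← he']; ring
    rw [ev] at h5
    exact h5
  · -- row 6
    rw [hΔh, hΔφ, hl1, hl2, hl3]
    simp only [crossF, mul_one, ← ha, ← hb, ← he, ← he']
    field_simp
    ring
  · -- row 7
    rw [hΔh, hΔφ, hl1, hl2, hl3]
    simp only [crossF, mul_one, ← ha, ← hb, ← he, ← he']
    field_simp
    ring

end Crossing

/-! ## §4 A1, A2, A4, A5 and the main theorem -/

section Axioms

variable {N : ℕ} {p q : ℝ}

/-- The scalar unitarity bound is `1/2`. Plumbing. [folklore] -/
private theorem bound_zero_lt (hq : 1 / 2 < q) : unitarityBound3D 0 < q := by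
  simpa [unitarityBound3D] using hq

/-- **A2**: every block function of the datum is genuine — `hrBlock` at points strictly above the unitarity
bound (`IsAdmissible3D.isConformalBlock3D_hrBlock`), `hrBlockAB` in both orderings at the `[φs]` points and for
the external `φ` (`isConformalBlock3D_hrBlockAB_of_lt`, accidental points included).
[cite: KosPolandSimmonsDuffinVichi2015, §2 (crossing equation and `F^{ij,kl}_∓`)] [cite: DolanOsborn2004, §3 eqs. (3.10)–(3.11)] -/
theorem gffArch_hasGenuineBlocks (hp : 1 / 2 < p) (hq : 1 / 2 < q) : (gffArch N p q).HasGenuineBlocks := by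
  refine ⟨(isAdmissible3D_of_lt (bound_zero_lt hq)).isConformalBlock3D_hrBlock,
    isConformalBlock3D_hrBlockAB_of_lt _ _ (bound_zero_lt hp),
    isConformalBlock3D_hrBlockAB_of_lt _ _ (bound_zero_lt hp), ?_, ?_, ?_, ?_, ?_⟩
  · rintro (nm | nm)
    · exact (isAdmissible3D_of_lt (gff_unitarity hp nm.1 nm.2)).isConformalBlock3D_hrBlock
    · exact (isAdmissible3D_of_lt (gff_unitarity hq nm.1 nm.2)).isConformalBlock3D_hrBlock
  · intro nm
    exact (isAdmissible3D_of_lt (gff_unitarity hp nm.1 nm.2)).isConformalBlock3D_hrBlock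
  · intro nm
    exact (isAdmissible3D_of_lt (unitarityBound3D_lt_twist hp nm.1 (2 * nm.2 + 1))).isConformalBlock3D_hrBlock
  · intro nl
    exact isConformalBlock3D_hrBlockAB_of_lt _ _ (pair_unitarity hp hq nl.1 nl.2)
  · intro nl
    exact isConformalBlock3D_hrBlockAB_of_lt _ _ (pair_unitarity hp hq nl.1 nl.2)

/-- **A1 (spectral part)**: `p, q ≥ 1/2`, unitarity bounds sector by sector, even spins in `S` and `T`, odd
spins in `A`. [cite: KosPolandSimmonsDuffinVichi2015, §2.2 (functional conditions)] [cite: FitzpatrickKaplan2012, §2.2] -/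
theorem gffArch_satisfiesUnitarity (hp : 1 / 2 < p) (hq : 1 / 2 < q) : (gffArch N p q).SatisfiesUnitarity := by
  refine ⟨hp.le, hq.le, ?_, fun nm => ⟨(gff_unitarity hp nm.1 nm.2).le, even_two_mul _⟩,
    fun nm => ⟨(unitarityBound3D_lt_twist hp nm.1 (2 * nm.2 + 1)).le, odd_two_mul_add_one _⟩,
    fun nl => (pair_unitarity hp hq nl.1 nl.2).le⟩
  rintro (nm | nm)
  · exact ⟨(gff_unitarity hp nm.1 nm.2).le, even_two_mul _⟩
  · exact ⟨(gff_unitarity hq nm.1 nm.2).le, even_two_mul _⟩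

/-- **A1 (convergence clauses)**: on the diagonal `z = z̄ = x ∈ (0,1)` the five reflection-positive weighted
sums converge (they are the `(x,x)` cases of §2). [cite: PappadopuloRychkovEspinRattazzi2012, §4.1, §5.1] -/
theorem gffArch_hasConvergentWeights (hp : 1 / 2 < p) (hq : 1 / 2 < q) :
    (gffArch N p q).HasConvergentWeights := by
  intro x hx0 hx1
  have hx : x ∈ Ioo (0 : ℝ) 1 := ⟨hx0, hx1⟩
  exact ⟨(hasSum_S_phiphi hp hx hx).summable, (hasSum_T hp hx hx).summable, (hasSum_A hp hx hx).summable,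
    (hasSum_S_ss hq hx hx).summable, (hasSum_Vp hp hq hx hx).summable⟩

/-- **A4 against `gffGapsON p q`**. [cite: KosPolandSimmonsDuffinVichi2015, §2.2 (assumptions; eq. example)] -/
theorem gffArch_satisfiesGaps (N : ℕ) (p q : ℝ) : (gffArch N p q).SatisfiesGaps (gffGapsON p q) := by
  refine ⟨fun i _ => ?_, fun j _ => ?_, fun i _ => ?_⟩
  · rcases i with nm | nm
    · show min (2 * p) (2 * q) ≤ 2 * p + 2 * nm.1 + 2 * nm.2
      linarith [min_le_left (2 * p) (2 * q), Nat.cast_nonneg (α := ℝ) nm.1, Nat.cast_nonneg (α := ℝ) nm.2]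
    · show min (2 * p) (2 * q) ≤ 2 * q + 2 * nm.1 + 2 * nm.2
      linarith [min_le_right (2 * p) (2 * q), Nat.cast_nonneg (α := ℝ) nm.1, Nat.cast_nonneg (α := ℝ) nm.2]
  · show p + q ≤ p + q + 2 * j.1 + j.2
    linarith [Nat.cast_nonneg (α := ℝ) j.1, Nat.cast_nonneg (α := ℝ) j.2]
  · show 2 * p ≤ 2 * p + 2 * i.1 + 2 * i.2
    linarith [Nat.cast_nonneg (α := ℝ) i.1, Nat.cast_nonneg (α := ℝ) i.2]

/-- **A5**: `λ_{φsφ} = λ_{φφs}` (both vanish). [cite: KosPolandSimmonsDuffinVichi2015, §2.2 (OPE-coefficient symmetry)] -/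
theorem gffArch_opeSymmetric (N : ℕ) (p q : ℝ) : (gffArch N p q).OPESymmetric := rfl

/-- **Non-vacuity of the typed `O(N)` archipelago axioms A1–A5.**  For every `N` and all `p, q > 1/2`, the
decoupled generalised free datum satisfies `SatisfiesBootstrapAxioms` against `gffGapsON p q`.
[cite: KosPolandSimmonsDuffinVichi2015, §2.2 (functional conditions)] [cite: HenrikssonVanLoon2018, §2 (generalized free O(N) correlator)]
[cite: FitzpatrickKaplan2012, §2.2] -/
theorem gffArch_satisfiesBootstrapAxioms (hp : 1 / 2 < p) (hq : 1 / 2 < q) :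
    (gffArch N p q).SatisfiesBootstrapAxioms (gffGapsON p q) :=
  ⟨gffArch_hasGenuineBlocks hp hq, gffArch_satisfiesUnitarity hp hq, gffArch_hasConvergentWeights hp hq,
    gffArch_satisfiesCrossing hp hq, gffArch_satisfiesGaps N p q, gffArch_opeSymmetric N p q⟩

/-- The same against any thresholds dominated by `gffGapsON p q`.
[cite: KosPolandSimmonsDuffinVichi2015, §2.2 (assumptions; eq. example)] -/
theorem gffArch_satisfiesBootstrapAxioms_of_le {A : ArchipelagoGaps} (hp : 1 / 2 < p) (hq : 1 / 2 < q)
    (hS : A.ΔSstar ≤ min (2 * p) (2 * q)) (hV : A.ΔVstar ≤ p + q) (hT : A.ΔTstar ≤ 2 * p) :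
    (gffArch N p q).SatisfiesBootstrapAxioms A :=
  (gffArch_satisfiesBootstrapAxioms hp hq).of_le hS hV hT

/-- **What an excluded box can never contain.**  If `Q` is excluded against thresholds `A` dominated by
`gffGapsON p q` (`p, q > 1/2`), then `(Δ_φ, Δ_s) = (p, q) ∉ Q`: a certificate claiming otherwise contradicts the
decoupled generalised free datum. [cite: KosPolandSimmonsDuffinVichi2015, §2.2 (functional conditions)]
[cite: HenrikssonVanLoon2018, §2 (generalized free O(N) correlator)] -/
theorem not_mem_of_archBoxExcluded {A : ArchipelagoGaps} {Q : Set (ℝ × ℝ)}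
    (h : ONArchipelagoSystem.BoxExcluded N A Q) (hp : 1 / 2 < p) (hq : 1 / 2 < q)
    (hS : A.ΔSstar ≤ min (2 * p) (2 * q)) (hV : A.ΔVstar ≤ p + q) (hT : A.ΔTstar ≤ 2 * p) : (p, q) ∉ Q :=
  h (gffArch N p q) (gffArch_satisfiesBootstrapAxioms_of_le hp hq hS hV hT)

/-- Contrapositive: a box containing an admitted generalised free point is not excluded.
[cite: KosPolandSimmonsDuffinVichi2015, §2.2 (functional conditions)] -/
theorem not_archBoxExcluded_of_mem {A : ArchipelagoGaps} {Q : Set (ℝ × ℝ)} (hp : 1 / 2 < p) (hq : 1 / 2 < q)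
    (hS : A.ΔSstar ≤ min (2 * p) (2 * q)) (hV : A.ΔVstar ≤ p + q) (hT : A.ΔTstar ≤ 2 * p)
    (hQ : (p, q) ∈ Q) : ¬ONArchipelagoSystem.BoxExcluded N A Q :=
  fun h => not_mem_of_archBoxExcluded h hp hq hS hV hT hQ

/-- **A certified singlet gap at an admitted point exceeds the free value**: if a box containing `(p, q)` is
excluded under thresholds `(Δ_S^*, Δ_V^*, Δ_T^*)` with `Δ_V^* ≤ p + q`, `Δ_T^* ≤ 2p`, then `Δ_S^* > min(2p, 2q)` —
the excluded region of any singlet-gap scan lies strictly above the generalised free line.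
[cite: KosPolandSimmonsDuffinVichi2015, §2.2 (functional conditions)] [cite: HenrikssonVanLoon2018, §2 (generalized free O(N) correlator)] -/
theorem min_lt_gapS_of_boxExcluded {A : ArchipelagoGaps} {Q : Set (ℝ × ℝ)}
    (h : ONArchipelagoSystem.BoxExcluded N A Q) (hp : 1 / 2 < p) (hq : 1 / 2 < q) (hQ : (p, q) ∈ Q)
    (hV : A.ΔVstar ≤ p + q) (hT : A.ΔTstar ≤ 2 * p) : min (2 * p) (2 * q) < A.ΔSstar :=
  lt_of_not_ge fun hS => not_mem_of_archBoxExcluded h hp hq hS hV hT hQ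

/-- **Every enclosure keeps the admitted generalised free points of its window** — the typed form of the
remark in `ONArchipelagoSystem` that "the window is essential (generalised free fields satisfy A1–A5 with
suitable thresholds)". [cite: KosPolandSimmonsDuffinVichi2015, §3.1 (O(2): gaps, OPE symmetry, closed island)] -/
theorem mem_of_archipelagoEnclosure {A : ArchipelagoGaps} {W R : Set (ℝ × ℝ)}
    (h : ArchipelagoEnclosure N A W R) (hp : 1 / 2 < p) (hq : 1 / 2 < q)
    (hS : A.ΔSstar ≤ min (2 * p) (2 * q)) (hV : A.ΔVstar ≤ p + q) (hT : A.ΔTstar ≤ 2 * p)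
    (hW : (p, q) ∈ W) : (p, q) ∈ R :=
  h (gffArch N p q) (gffArch_satisfiesBootstrapAxioms_of_le hp hq hS hV hT) hW

/-- **The source's island thresholds** `Δ_S^* = Δ_V^* = 3` dominate `gffGapsON p q` exactly on the quadrant
`p, q ≥ 3/2`; in particular they do NOT near the printed islands (`Δ_φ ≈ 0.52`), so the decoupled datum is
no obstruction to those exclusions — as it must not be — while every `(p, q)` with `p, q ≥ 3/2` is admitted
even under them. [cite: KosPolandSimmonsDuffinVichi2015, §2.2 (assumptions; eq. example)] -/
theorem three_le_gffGapsON_iff :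
    (3 ≤ (gffGapsON p q).ΔSstar ∧ 3 ≤ (gffGapsON p q).ΔVstar) ↔ 3 / 2 ≤ p ∧ 3 / 2 ≤ q := by
  simp only [gffGapsON, le_min_iff]
  constructor
  · rintro ⟨⟨h1, h2⟩, -⟩
    exact ⟨by linarith, by linarith⟩
  · rintro ⟨h1, h2⟩
    exact ⟨⟨by linarith, by linarith⟩, by linarith⟩

/-- Under the source's thresholds `(3, 3, Δ_T^*)` with `Δ_T^* ≤ 2p`, no excluded box contains a point of the
quadrant `p, q ≥ 3/2`. [cite: KosPolandSimmonsDuffinVichi2015, §2.2 (assumptions; eq. example)] -/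
theorem not_mem_of_archBoxExcluded_three {T : ℝ} {Q : Set (ℝ × ℝ)} (h : ONArchipelagoSystem.BoxExcluded N ⟨3, 3, T⟩ Q)
    (hp : 3 / 2 ≤ p) (hq : 3 / 2 ≤ q) (hT : T ≤ 2 * p) : (p, q) ∉ Q :=
  not_mem_of_archBoxExcluded h (by linarith) (by linarith) (le_min (by linarith) (by linarith)) (by linarith) hT

end Axioms

end Literature.MathematicalPhysics.QuantumFieldTheory.ONArchipelagoNonVacuity
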